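import Summits.Ventures.PercRepro.RankLevelSetFourCircuitNullityThreeSharp
import Summits.Ventures.PercRepro.RankLevelSetFourCircuitNullityFour

/-!
# PercRepro — THE NULLITY-4 CAP `s₄ ≤ 14` AND THE AVERAGING CHAIN FROM IT (p8 g8, S3)

`proofs/P8-S3-NULLITY3-SHARP.md` §2. A core of nullity `4` has at least `8` non-coloops (`card_nonColoops_ge_eight`: the
non-coloop part `E'` has `|E'| = r(E') + 4`; `r(E') ≤ 3` would give `|E'| ≤ 6` (planes), hence `r(E') ≤ 2` and `|E'| ≤ 3`
(lines), against `|E'| ≥ 4`). With the sharp nullity-`3` cap `7` (RankLevelSetFourCircuitNullityThreeSharp), p2's averaging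
step with `m = 8` gives `s₄ − ⌊4·s₄/8⌋ ≤ 7`, i.e. **`s₄ ≤ 14` on every `e`-free core of nullity `4`**
(`ncard_fourCircuits_le_fourteen_of_nullity_four`; the tree's `16`), and the chain `avgChain14 = 0, 1, 5, 7, 14, 25, 41,
61, 88, 123, 167, 222, 290, 372, 471, …` (`ncard_fourCircuits_le_avgChain14`; the tree's `avgChain16` is `16, 28, 46, 69,
99, 138, 188, 250, 326, 419, 530`). Axioms: standard.
-/

open scoped Matroid

namespace PercRepro

namespace ThmN

open Set

variable {α : Type}

/-- **The non-coloops of a core of nullity `4` number at least `8`**: with `K` the coloops and `E' = E ∖ K`,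
`r(E) = r(E') + |K|`, so `|E'| = r(E') + 4`; `r(E') ≤ 3` would give `|E'| ≤ 6` (planes of the core), hence `r(E') ≤ 2` and
`|E'| ≤ 3` (`|X| + 1 ≤ 2^{r(X)}`) — against `|E'| ≥ 4` (p2's `card_nonColoops_ge_nine` at nullity `4`). -/
theorem card_nonColoops_ge_eight (M : Matroid α) [M.Finite]
    (hfree : ∀ e ∈ M.E, ∃ A ⊆ M.E \ {e}, e ∉ M.closure A ∧ e ∉ M.closure ((M.E \ {e}) \ A))
    (hd : M.E.encard = M.eRank + 4) :
    8 ≤ (M.E \ M.coloops).ncard := by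
  have hK : M.coloops ⊆ M.E := M.coloops_subset_ground
  have hE' : M.E \ M.coloops ⊆ M.E := sdiff_subset
  have hunion : (M.E \ M.coloops) ∪ M.coloops = M.E := sdiff_union_of_subset hK
  have hr := PercRepro.eRk_union_subset_coloops (M := M) hE' subset_rfl disjoint_sdiff_left
  rw [hunion, ← _root_.Matroid.eRank_def] at hr
  have hcard := ncard_sdiff_add_ncard_of_subset hK M.ground_finite
  -- everything is finite: pass to ℕ
  have hKfin : M.coloops.Finite := M.ground_finite.subset hK
  have hrE' : M.eRk (M.E \ M.coloops) ≠ ⊤ :=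
    ne_top_of_le_ne_top (M.ground_finite.subset hE').encard_lt_top.ne (M.eRk_le_encard _)
  obtain ⟨r', hr'⟩ := ENat.ne_top_iff_exists.1 hrE'
  obtain ⟨R, hR⟩ := ENat.ne_top_iff_exists.1 (PercRepro.Matroid.eRank_ne_top_of_finite M)
  have hRk : R = r' + M.coloops.ncard := by
    have := hr
    rw [← hR, ← hr', ← Set.Finite.cast_ncard_eq hKfin] at this
    exact_mod_cast this
  have hEn : M.E.ncard = R + 4 := by
    have := hd
    rw [← hR, ← Set.Finite.cast_ncard_eq M.ground_finite] at this
    exact_mod_cast this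
  have hE'n : (M.E \ M.coloops).ncard = r' + 4 := by omega
  -- `r' ≥ 4` by the core's point bounds
  by_contra hlt
  push Not at hlt
  have hr'3 : r' ≤ 3 := by omega
  have h6 := ThmN.ncard_le_six_of_eRk_le_three_of_free M hfree hE' (by rw [← hr']; exact_mod_cast hr'3)
  have hr'2 : r' ≤ 2 := by omega
  have h2 := ThmN.ncard_add_one_le_two_pow_of_eRk_le M (ThmN.not_isLoop_of_free M hfree) hfree 2
    (M.E \ M.coloops) hE' (by rw [← hr']; exact_mod_cast hr'2)
  norm_num at h2
  omega

/-- **`s₄ ≤ 14` on every `e`-free core of nullity `4`** (the tree's `16`): p2's averaging step with `m = 8` non-coloops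
on the sharp nullity-`3` cap `7` — `s₄ − ⌊4·s₄/8⌋ ≤ 7`. -/
theorem ncard_fourCircuits_le_fourteen_of_nullity_four (M : Matroid α) [M.Finite]
    (hfree : ∀ e ∈ M.E, ∃ A ⊆ M.E \ {e}, e ∉ M.closure A ∧ e ∉ M.closure ((M.E \ {e}) \ A))
    (hd : M.E.encard = M.eRank + 4) : {C : Set α | M.IsCircuit C ∧ C.ncard = 4}.ncard ≤ 14 := by
  have hd' : M.E.encard = M.eRank + ((3 : ℕ) + 1) := by rw [hd]; norm_num
  have h := S1.ncard_fourCircuits_sub_div_le_of_nonColoops M hfree hd' (m := 8) (by norm_num)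
    (card_nonColoops_ge_eight M hfree hd) (B := 7)
    (fun M' _ hfree' hd3 => ncard_fourCircuits_le_seven_of_nullity_three M' hfree' (by exact_mod_cast hd3))
  omega

/-- **The averaging chain from the nullity-`4` cap `14`**: `0, 1, 5, 7, 14`, then `25` (`m = 9`), `41` (`m = 10`), then
`avgChain14 (n + 7) = ⌊(n + 12)·avgChain14 (n + 6)/(n + 8)⌋`: `61, 88, 123, 167, 222, 290, 372, 471, …` (the tree's
`avgChain16` is `16, 28, 46, 69, 99, 138, 188, 250, 326, 419, 530`). -/
def avgChain14 : ℕ → ℕ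
  | 0 => 0
  | 1 => 1
  | 2 => 5
  | 3 => 7
  | 4 => 14
  | 5 => 25
  | 6 => 41
  | n + 7 => (n + 12) * avgChain14 (n + 6) / (n + 12 - 4)

/-- The values `avgChain14 7 … 14 = 61, 88, 123, 167, 222, 290, 372, 471`. -/
theorem avgChain14_values : avgChain14 7 = 61 ∧ avgChain14 8 = 88 ∧ avgChain14 9 = 123 ∧ avgChain14 10 = 167 ∧
    avgChain14 11 = 222 ∧ avgChain14 12 = 290 ∧ avgChain14 13 = 372 ∧ avgChain14 14 = 471 := by decide

/-- `avgChain14 ≤ avgChain16` at every nullity (the new chain dominates nowhere above the old one). -/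
theorem avgChain14_le_avgChain16 : ∀ j, avgChain14 j ≤ avgChain16 j
  | 0 | 1 | 2 | 3 | 4 | 5 | 6 => by decide
  | n + 7 => by
    show (n + 12) * avgChain14 (n + 6) / (n + 12 - 4) ≤ (n + 12) * avgChain16 (n + 6) / (n + 12 - 4)
    exact Nat.div_le_div_right (Nat.mul_le_mul_left _ (avgChain14_le_avgChain16 (n + 6)))

/-- **`s₄ ≤ avgChain14 ν` on every `e`-free core of nullity `ν`, unconditionally** — the kernel table at `ν ≤ 2`, the sharp
cap at `ν = 3`, `14` at `ν = 4`, p2's averaging step with `m = 9, 10` at `ν = 5, 6` and p1's with `m = ν + 5` beyond. -/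
theorem ncard_fourCircuits_le_avgChain14 : ∀ (j : ℕ) (M : Matroid α) [M.Finite],
    (∀ e ∈ M.E, ∃ A ⊆ M.E \ {e}, e ∉ M.closure A ∧ e ∉ M.closure ((M.E \ {e}) \ A)) →
    M.E.encard = M.eRank + j → {C : Set α | M.IsCircuit C ∧ C.ncard = 4}.ncard ≤ avgChain14 j
  | 0, M, _, hfree, hd => (S1.ncard_fourCircuits_le_capKer M hfree hd).trans (by decide)
  | 1, M, _, hfree, hd => (S1.ncard_fourCircuits_le_capKer M hfree hd).trans (by decide)
  | 2, M, _, hfree, hd => (S1.ncard_fourCircuits_le_capKer M hfree hd).trans (by decide)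
  | 3, M, _, hfree, hd => ncard_fourCircuits_le_seven_of_nullity_three M hfree (by exact_mod_cast hd)
  | 4, M, _, hfree, hd => ncard_fourCircuits_le_fourteen_of_nullity_four M hfree (by exact_mod_cast hd)
  | 5, M, _, hfree, hd => by
    have hd' : M.E.encard = M.eRank + ((4 : ℕ) + 1) := by rw [hd]; norm_num
    have h := S1.ncard_fourCircuits_sub_div_le_of_nonColoops M hfree hd' (m := 9) (by norm_num)
      (S1.card_nonColoops_ge_nine M hfree (by exact_mod_cast hd)) (B := 14)
      (fun M' _ hfree' hd4 => ncard_fourCircuits_le_fourteen_of_nullity_four M' hfree' (by exact_mod_cast hd4))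
    show _ ≤ 25
    omega
  | 6, M, _, hfree, hd => by
    have hd' : M.E.encard = M.eRank + ((5 : ℕ) + 1) := by rw [hd]; norm_num
    have h := S1.ncard_fourCircuits_sub_div_le_of_nonColoops M hfree hd' (m := 10) (by norm_num)
      (S1.card_nonColoops_ge_ten M hfree (by exact_mod_cast hd)) (B := 25)
      (fun M' _ hfree' hd5 => ncard_fourCircuits_le_avgChain14 5 M' hfree' (by exact_mod_cast hd5))
    show _ ≤ 41
    omega
  | n + 7, M, _, hfree, hd => by
    have hd' : M.E.encard = M.eRank + ((n + 6 : ℕ) + 1) := by rw [hd]; push_cast; ring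
    have h := S1.ncard_fourCircuits_sub_div_le M hfree (d := n + 6) hd' (by omega)
      (fun M' _ hfree' hd6 => ncard_fourCircuits_le_avgChain14 (n + 6) M' hfree' hd6)
    have h2 := S1.le_mul_div_of_sub_div_le (m := n + 12) (by omega) h
    show _ ≤ (n + 12) * avgChain14 (n + 6) / (n + 12 - 4)
    exact h2

end ThmN

end PercRepro
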